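import Literature.Geometry.Lorentzian.InitialDataHomothety
import Literature.Geometry.Lorentzian.AsymptoticFlatness
import Literature.Geometry.Lorentzian.ChartSecondFundamentalForm

/-!
# Transport of asymptotically flat ends along diffeomorphisms and under constant rescaling

* `AFEnd.comap e Φ` — the end `Φ⁻¹(e)` of `Y` for a diffeomorphism `Φ : Y ≅ X` and an end `e` of
  `X`; its chart coefficients for the pulled-back data `Φ^* D` are those of `D` VERBATIM
  (`hCoeff_comap`, `kCoeff_comap`), so sole-ness and strong asymptotic flatness transport.
* `AFEnd.rescaleEnd e l` — the same end with chart scaled by `l > 0` (radius `l R`); for the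
  rescaled data `(l² h, l k)` (`InitialDataSet.homothety`) its coefficients are
  `x ↦ hCoeff e D (x/l)`, `x ↦ l⁻¹ kCoeff e D (x/l)` (`hCoeff_rescaleEnd`, `kCoeff_rescaleEnd`).
The decay rates are transported in `AFEndDilationDecay.lean`. Bartnik 1986, §1;
Dafermos–Rodnianski 2013, App. B.2.3. Everything is proved; no named facts.

## References

* R. Bartnik, *The mass of an asymptotically flat manifold*, CPAM 39 (1986), §1. [Bartnik1986]
* M. Dafermos, I. Rodnianski, *Lectures on black holes and linear waves* (2013), App. B.2.3.
  [DafermosRodnianski2013]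
-/

noncomputable section

-- instance search through the nested operator type `E3 →L[ℝ] E3 →L[ℝ] ℝ` (as in the tree files)
set_option maxSynthPendingDepth 3

open Bundle Set Function Filter Manifold Bornology Asymptotics TopologicalSpace
open scoped Manifold ContDiff Topology

namespace Literature.Geometry.Lorentzian

namespace AFEnd

variable {X : Type*} [TopologicalSpace X] [ChartedSpace E3 X]
  {Y : Type*} [TopologicalSpace Y] [ChartedSpace E3 Y]

/-! ### Transport along a diffeomorphism -/

section Comap

variable (e : AFEnd X) (Φ : Diffeomorph (𝓡 3) (𝓡 3) Y X ∞)

/-- The open end `Φ⁻¹(U) ⊆ Y`. [folklore] -/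
def comapU : Opens Y := ⟨Φ ⁻¹' (e.U : Set X), e.U.isOpen.preimage Φ.continuous⟩

/-- The restriction `Φ⁻¹(U) ≃ U` of `Φ`. [folklore] -/
def comapUEquiv : comapU e Φ ≃ e.U where
  toFun y := ⟨Φ y, y.2⟩
  invFun u := ⟨Φ.symm u, show Φ (Φ.symm u) ∈ e.U by rw [Φ.apply_symm_apply]; exact u.2⟩
  left_inv y := Subtype.ext (Φ.symm_apply_apply y)
  right_inv u := Subtype.ext (Φ.apply_symm_apply u)

/-- The restriction of `Φ` is smooth. [folklore] -/
theorem contMDiff_comapUEquiv : ContMDiff (𝓡 3) (𝓡 3) ∞ (comapUEquiv e Φ) :=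
  (ContMDiff.subtypeVal_comp_iff _ _).1 (Φ.contMDiff.comp contMDiff_subtype_val)

/-- The inverse restriction of `Φ` is smooth. [folklore] -/
theorem contMDiff_comapUEquiv_symm : ContMDiff (𝓡 3) (𝓡 3) ∞ (comapUEquiv e Φ).symm :=
  (ContMDiff.subtypeVal_comp_iff _ _).1 (Φ.symm.contMDiff.comp contMDiff_subtype_val)

/-- The restriction `Φ⁻¹(U) ≅ U` of `Φ` as a diffeomorphism. [folklore] -/
def comapUDiffeo : Diffeomorph (𝓡 3) (𝓡 3) (comapU e Φ) e.U ∞ where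
  toEquiv := comapUEquiv e Φ
  contMDiff_toFun := contMDiff_comapUEquiv e Φ
  contMDiff_invFun := contMDiff_comapUEquiv_symm e Φ

/-- **The end `Φ⁻¹(e)` of `Y`** transported along the diffeomorphism `Φ : Y ≅ X`: open set
`Φ⁻¹(U)`, same radius, chart `chart ∘ Φ`. Bartnik 1986, §1 (structures of infinity).
[cite: Bartnik1986, §1] -/
def comap : AFEnd Y where
  U := comapU e Φ
  R := e.R
  R_pos := e.R_pos
  chart := (comapUDiffeo e Φ).trans e.chart
  isClosed_far R' hR' := by
    have key : ((↑) : comapU e Φ → Y) '' (((comapUDiffeo e Φ).trans e.chart) ⁻¹'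
        {x | R' ≤ ‖(x : E3)‖}) = Φ ⁻¹' (((↑) : e.U → X) '' (e.chart ⁻¹' {x | R' ≤ ‖(x : E3)‖})) := by
      ext y
      constructor
      · rintro ⟨y', hy', rfl⟩
        exact ⟨⟨Φ y', y'.2⟩, hy', rfl⟩
      · rintro ⟨u, hu, hΦy⟩
        have hy : y ∈ comapU e Φ := show Φ y ∈ e.U from hΦy ▸ u.2
        refine ⟨⟨y, hy⟩, ?_, rfl⟩
        have : comapUEquiv e Φ ⟨y, hy⟩ = u := Subtype.ext hΦy.symm
        show R' ≤ ‖(e.chart (comapUEquiv e Φ ⟨y, hy⟩) : E3)‖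
        rw [this]; exact hu
    rw [key]
    exact (e.isClosed_far R' hR').preimage Φ.continuous

/-- The radius of the transported end. [folklore] -/
@[simp]
theorem comap_R : (e.comap Φ).R = e.R := rfl

/-- The far regions of the transported end are the preimages of the far regions. [folklore] -/
theorem far_comap (ρ : ℝ) : (e.comap Φ).far ρ = Φ ⁻¹' e.far ρ := by
  ext y
  constructor
  · rintro ⟨y', hy', rfl⟩
    exact ⟨⟨Φ y', y'.2⟩, hy', rfl⟩
  · rintro ⟨u, hu, hΦy⟩
    have hy : y ∈ comapU e Φ := show Φ y ∈ e.U from hΦy ▸ u.2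
    refine ⟨⟨y, hy⟩, ?_, rfl⟩
    have : comapUEquiv e Φ ⟨y, hy⟩ = u := Subtype.ext hΦy.symm
    show ρ < ‖(e.chart (comapUEquiv e Φ ⟨y, hy⟩) : E3)‖
    rw [this]; exact hu

/-- Sole-ness transports along diffeomorphisms. [folklore] -/
theorem isSoleEnd_comap (h : e.IsSoleEnd) : (e.comap Φ).IsSoleEnd := by
  obtain ⟨R', hR', hc⟩ := h
  refine ⟨R', hR', ?_⟩
  rw [far_comap, ← preimage_compl, ← Φ.coe_toHomeomorph]
  exact Φ.toHomeomorph.isCompact_preimage.2 hc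

/-- The inverse chart of the transported end is `Φ⁻¹ ∘ dataChart e`. [folklore] -/
theorem dataChart_comap : (e.comap Φ).dataChart = Φ.symm ∘ e.dataChart := rfl

variable [IsManifold (𝓡 3) ∞ X] [IsManifold (𝓡 3) ∞ Y] (D : InitialDataSet (𝓡 3) X)
  (hΦ : ContMDiff (𝓡 3) (𝓡 3) (∞ + 1) Φ) (hΦ' : ∀ u, Injective (mfderiv (𝓡 3) (𝓡 3) Φ u))

omit [IsManifold (𝓡 3) ∞ X] [IsManifold (𝓡 3) ∞ Y] in
/-- `Φ ∘ Φ⁻¹ ∘ dataChart e = dataChart e`. [folklore] -/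
theorem comp_dataChart_comap : Φ ∘ (e.comap Φ).dataChart = e.dataChart := by
  funext x
  simp [dataChart_comap]

/-- **The metric coefficients of `Φ^* D` in the transported end are those of `D`.**
[folklore] -/
theorem hCoeff_comap (x : E3) : hCoeff (e.comap Φ) (D.comap Φ hΦ hΦ') x = hCoeff e D x := by
  by_cases hx : e.R < ‖x‖
  · rw [hCoeff_of_lt _ (show (e.comap Φ).R < ‖x‖ from hx), hCoeff_of_lt _ hx]
    change pullbackBilin (I := 𝓡 3) (I' := 𝓡 3) (e.comap Φ).dataChart
        (pullbackBilin (I := 𝓡 3) (I' := 𝓡 3) Φ D.h.inner) ⟨x, hx⟩ = _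
    rw [← pullbackBilin_comp (Φ.contMDiff.mdifferentiable (by simp))
      ((e.comap Φ).contMDiff_dataChart.mdifferentiable (by simp)), comp_dataChart_comap]
    rfl
  · unfold hCoeff
    rw [dif_neg hx, dif_neg (show ¬ (e.comap Φ).R < ‖x‖ from hx)]

/-- **The `k` coefficients of `Φ^* D` in the transported end are those of `D`.** [folklore] -/
theorem kCoeff_comap (x : E3) : kCoeff (e.comap Φ) (D.comap Φ hΦ hΦ') x = kCoeff e D x := by
  by_cases hx : e.R < ‖x‖
  · rw [kCoeff_of_lt _ (show (e.comap Φ).R < ‖x‖ from hx), kCoeff_of_lt _ hx]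
    change pullbackBilin (I := 𝓡 3) (I' := 𝓡 3) (e.comap Φ).dataChart
        (pullbackBilin (I := 𝓡 3) (I' := 𝓡 3) Φ D.k) ⟨x, hx⟩ = _
    rw [← pullbackBilin_comp (Φ.contMDiff.mdifferentiable (by simp))
      ((e.comap Φ).contMDiff_dataChart.mdifferentiable (by simp)), comp_dataChart_comap]
    rfl
  · unfold kCoeff
    rw [dif_neg hx, dif_neg (show ¬ (e.comap Φ).R < ‖x‖ from hx)]

/-- **Strong asymptotic flatness transports along diffeomorphisms** (same coefficients).
Dafermos–Rodnianski 2013, App. B.2.3. [cite: DafermosRodnianski2013, App. B.2.3] -/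
theorem isStronglyAsymptoticallyFlatDR_comap {M : ℝ} (h : e.IsStronglyAsymptoticallyFlatDR D M) :
    (e.comap Φ).IsStronglyAsymptoticallyFlatDR (D.comap Φ hΦ hΦ') M := by
  have h1 : hCoeff (e.comap Φ) (D.comap Φ hΦ hΦ') = hCoeff e D := funext (e.hCoeff_comap Φ D hΦ hΦ')
  have h2 : kCoeff (e.comap Φ) (D.comap Φ hΦ hΦ') = kCoeff e D := funext (e.kCoeff_comap Φ D hΦ hΦ')
  unfold IsStronglyAsymptoticallyFlatDR IsStronglyAsymptoticallyFlatWith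
  rw [h1, h2]
  exact h

end Comap

/-! ### Constant rescaling of the chart -/

section Rescale

variable (l : ℝ) (hl : 0 < l)

/-- Scaling `x ↦ l x` of exterior regions, `{R < ‖x‖} ≃ {l R < ‖x‖}`. [folklore] -/
def scaleExteriorEquiv (R : ℝ) : exteriorRegion R ≃ exteriorRegion (l * R) where
  toFun x := ⟨l • (x : E3), by
    show l * R < ‖l • (x : E3)‖
    rw [norm_smul, Real.norm_of_nonneg hl.le]
    exact mul_lt_mul_of_pos_left x.2 hl⟩
  invFun x := ⟨l⁻¹ • (x : E3), by
    show R < ‖l⁻¹ • (x : E3)‖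
    rw [norm_smul, Real.norm_of_nonneg (inv_nonneg.2 hl.le), lt_inv_mul_iff₀ hl]
    exact x.2⟩
  left_inv x := Subtype.ext (show l⁻¹ • (l • (x : E3)) = x by
    rw [smul_smul, inv_mul_cancel₀ hl.ne', one_smul])
  right_inv x := Subtype.ext (show l • (l⁻¹ • (x : E3)) = x by
    rw [smul_smul, mul_inv_cancel₀ hl.ne', one_smul])

/-- The scaling of exterior regions is smooth. [folklore] -/
theorem contMDiff_scaleExteriorEquiv (R : ℝ) :
    ContMDiff (𝓡 3) (𝓡 3) ∞ (scaleExteriorEquiv l hl R) :=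
  (ContMDiff.subtypeVal_comp_iff _ _).1
    ((l • ContinuousLinearMap.id ℝ E3).contDiff.contMDiff.comp contMDiff_subtype_val)

/-- The inverse scaling of exterior regions is smooth. [folklore] -/
theorem contMDiff_scaleExteriorEquiv_symm (R : ℝ) :
    ContMDiff (𝓡 3) (𝓡 3) ∞ (scaleExteriorEquiv l hl R).symm :=
  (ContMDiff.subtypeVal_comp_iff _ _).1
    ((l⁻¹ • ContinuousLinearMap.id ℝ E3).contDiff.contMDiff.comp contMDiff_subtype_val)

/-- Scaling of exterior regions as a diffeomorphism. [folklore] -/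
def scaleExterior (R : ℝ) : Diffeomorph (𝓡 3) (𝓡 3) (exteriorRegion R) (exteriorRegion (l * R)) ∞ where
  toEquiv := scaleExteriorEquiv l hl R
  contMDiff_toFun := contMDiff_scaleExteriorEquiv l hl R
  contMDiff_invFun := contMDiff_scaleExteriorEquiv_symm l hl R

/-- The inverse scaling in coordinates: `x ↦ l⁻¹ x`. [folklore] -/
theorem coe_scaleExterior_symm (R : ℝ) (x : exteriorRegion (l * R)) :
    (((scaleExterior l hl R).symm x : exteriorRegion R) : E3) = l⁻¹ • (x : E3) := rfl

/-- The differential of the inverse scaling: `v ↦ l⁻¹ v`. [folklore] -/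
theorem mfderiv_scaleExterior_symm_apply (R : ℝ) (x : exteriorRegion (l * R)) (v : E3) :
    mfderiv (𝓡 3) (𝓡 3) (scaleExterior l hl R).symm x v = l⁻¹ • v := by
  rw [OpensChart.mfderiv_apply_of_repr (f := (scaleExterior l hl R).symm)
    (Φ := fun y : E3 ↦ l⁻¹ • y) (fun y ↦ rfl) ((l⁻¹ • ContinuousLinearMap.id ℝ E3).differentiableAt)]
  exact congrFun (congrArg DFunLike.coe (l⁻¹ • ContinuousLinearMap.id ℝ E3).fderiv) v

variable (e : AFEnd X)

/-- **The end with chart scaled by `l > 0`**: same open set, radius `l R`, chart `l · chart`.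
Bartnik 1986, §1. [cite: Bartnik1986, §1] -/
def rescaleEnd : AFEnd X where
  U := e.U
  R := l * e.R
  R_pos := mul_pos hl e.R_pos
  chart := e.chart.trans (scaleExterior l hl e.R)
  isClosed_far R' hR' := by
    have hR'l : e.R < R' / l := by rwa [lt_div_iff₀ hl, mul_comm]
    have key : ((↑) : e.U → X) '' ((e.chart.trans (scaleExterior l hl e.R)) ⁻¹'
        {x | R' ≤ ‖(x : E3)‖}) = ((↑) : e.U → X) '' (e.chart ⁻¹' {x | R' / l ≤ ‖(x : E3)‖}) := by
      congr 1
      ext u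
      show R' ≤ ‖l • (e.chart u : E3)‖ ↔ R' / l ≤ ‖(e.chart u : E3)‖
      rw [norm_smul, Real.norm_of_nonneg hl.le, div_le_iff₀ hl, mul_comm]
    rw [key]
    exact e.isClosed_far _ hR'l

/-- The radius of the rescaled end. [folklore] -/
@[simp]
theorem rescaleEnd_R : (e.rescaleEnd l hl).R = l * e.R := rfl

/-- The far regions of the rescaled end: `far' (l ρ) = far ρ`. [folklore] -/
theorem far_rescaleEnd (ρ : ℝ) : (e.rescaleEnd l hl).far (l * ρ) = e.far ρ := by
  unfold far
  congr 1
  ext u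
  show l * ρ < ‖l • (e.chart u : E3)‖ ↔ ρ < ‖(e.chart u : E3)‖
  rw [norm_smul, Real.norm_of_nonneg hl.le]
  exact ⟨fun h ↦ lt_of_mul_lt_mul_left h hl.le, fun h ↦ mul_lt_mul_of_pos_left h hl⟩

/-- Sole-ness is invariant under rescaling of the chart. [folklore] -/
theorem isSoleEnd_rescaleEnd (h : e.IsSoleEnd) : (e.rescaleEnd l hl).IsSoleEnd := by
  obtain ⟨R', hR', hc⟩ := h
  refine ⟨l * R', ?_, ?_⟩
  · show l * e.R < l * R'
    exact mul_lt_mul_of_pos_left hR' hl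
  · rw [far_rescaleEnd]
    exact hc

/-- The inverse scaling read on the exterior region of the rescaled end,
`{l R < ‖x‖} → {R < ‖x‖}`, `x ↦ x/l` (stated at the end's own radius, for rewriting). [folklore] -/
def rescaleBack : exteriorRegion (e.rescaleEnd l hl).R → exteriorRegion e.R :=
  fun x ↦ (scaleExterior l hl e.R).symm x

/-- `rescaleBack x = x/l` in coordinates. [folklore] -/
theorem coe_rescaleBack (x : exteriorRegion (e.rescaleEnd l hl).R) :
    (e.rescaleBack l hl x : E3) = l⁻¹ • (x : E3) := rfl

/-- `rescaleBack` is smooth. [folklore] -/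
theorem contMDiff_rescaleBack : ContMDiff (𝓡 3) (𝓡 3) ∞ (e.rescaleBack l hl) :=
  (scaleExterior l hl e.R).symm.contMDiff

/-- The differential of `rescaleBack`: `v ↦ l⁻¹ v`. [folklore] -/
theorem mfderiv_rescaleBack_apply (x : exteriorRegion (e.rescaleEnd l hl).R) (v : E3) :
    mfderiv (𝓡 3) (𝓡 3) (e.rescaleBack l hl) x v = l⁻¹ • v := by
  rw [OpensChart.mfderiv_apply_of_repr (f := e.rescaleBack l hl)
    (Φ := fun y : E3 ↦ l⁻¹ • y) (fun y ↦ rfl) ((l⁻¹ • ContinuousLinearMap.id ℝ E3).differentiableAt)]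
  exact congrFun (congrArg DFunLike.coe (l⁻¹ • ContinuousLinearMap.id ℝ E3).fderiv) v

/-- The inverse chart of the rescaled end is `dataChart e ∘ (x ↦ x/l)`. [folklore] -/
theorem dataChart_rescaleEnd : (e.rescaleEnd l hl).dataChart = e.dataChart ∘ e.rescaleBack l hl :=
  rfl

variable [IsManifold (𝓡 3) ∞ X] (D : InitialDataSet (𝓡 3) X)

/-- Bilinear bookkeeping: `B(A(l⁻¹ v), A(l⁻¹ w)) = l⁻² B(A v, A w)`. [folklore] -/
theorem bilin_smul_smul (B : E3 →L[ℝ] E3 →L[ℝ] ℝ) (A : E3 →L[ℝ] E3) (v w : E3) :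
    B (A (l⁻¹ • v)) (A (l⁻¹ • w)) = l⁻¹ * l⁻¹ * B (A v) (A w) := by
  simp only [map_smul, FunLike.coe_smul, Pi.smul_apply, smul_eq_mul]
  ring

/-- **The metric coefficients of the rescaled data in the rescaled end**:
`hCoeff (e.rescaleEnd l) (l² h, l k) x = hCoeff e D (x/l)`. [folklore] -/
theorem hCoeff_rescaleEnd (x : E3) :
    hCoeff (e.rescaleEnd l hl) (D.homothety l hl) x = hCoeff e D (l⁻¹ • x) := by
  by_cases hx : l * e.R < ‖x‖
  · have hxR : (e.rescaleEnd l hl).R < ‖x‖ := hx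
    have hx' : e.R < ‖l⁻¹ • x‖ := by
      rw [norm_smul, Real.norm_of_nonneg (inv_nonneg.2 hl.le), lt_inv_mul_iff₀ hl]; exact hx
    rw [hCoeff_of_lt _ hxR, hCoeff_of_lt _ hx', dataChart_rescaleEnd,
      pullbackBilin_comp (e.contMDiff_dataChart.mdifferentiable (by simp))
        ((e.contMDiff_rescaleBack l hl).mdifferentiable (by simp))]
    have hp : e.rescaleBack l hl ⟨x, hxR⟩ = ⟨l⁻¹ • x, hx'⟩ := rfl
    ext v w
    change l ^ 2 * (show E3 →L[ℝ] E3 →L[ℝ] ℝ from D.h.inner (e.dataChart (e.rescaleBack l hl ⟨x, hxR⟩)))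
        ((show E3 →L[ℝ] E3 from mfderiv (𝓡 3) (𝓡 3) e.dataChart (e.rescaleBack l hl ⟨x, hxR⟩))
          (mfderiv (𝓡 3) (𝓡 3) (e.rescaleBack l hl) ⟨x, hxR⟩ v))
        ((show E3 →L[ℝ] E3 from mfderiv (𝓡 3) (𝓡 3) e.dataChart (e.rescaleBack l hl ⟨x, hxR⟩))
          (mfderiv (𝓡 3) (𝓡 3) (e.rescaleBack l hl) ⟨x, hxR⟩ w)) =
      (show E3 →L[ℝ] E3 →L[ℝ] ℝ from D.h.inner (e.dataChart ⟨l⁻¹ • x, hx'⟩))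
        ((show E3 →L[ℝ] E3 from mfderiv (𝓡 3) (𝓡 3) e.dataChart ⟨l⁻¹ • x, hx'⟩) v)
        ((show E3 →L[ℝ] E3 from mfderiv (𝓡 3) (𝓡 3) e.dataChart ⟨l⁻¹ • x, hx'⟩) w)
    rw [mfderiv_rescaleBack_apply, mfderiv_rescaleBack_apply, hp, bilin_smul_smul]
    field_simp [hl.ne']
  · have hx' : ¬ e.R < ‖l⁻¹ • x‖ := by
      rw [norm_smul, Real.norm_of_nonneg (inv_nonneg.2 hl.le), lt_inv_mul_iff₀ hl]; exact hx
    unfold hCoeff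
    rw [dif_neg (show ¬ (e.rescaleEnd l hl).R < ‖x‖ from hx), dif_neg hx']

/-- **The `k` coefficients of the rescaled data in the rescaled end** (pointwise):
`kCoeff (e.rescaleEnd l) (l² h, l k) x v w = l⁻¹ kCoeff e D (x/l) v w`. [folklore] -/
theorem kCoeff_rescaleEnd_apply (x v w : E3) :
    kCoeff (e.rescaleEnd l hl) (D.homothety l hl) x v w = l⁻¹ * kCoeff e D (l⁻¹ • x) v w := by
  by_cases hx : l * e.R < ‖x‖
  · have hxR : (e.rescaleEnd l hl).R < ‖x‖ := hx
    have hx' : e.R < ‖l⁻¹ • x‖ := by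
      rw [norm_smul, Real.norm_of_nonneg (inv_nonneg.2 hl.le), lt_inv_mul_iff₀ hl]; exact hx
    rw [kCoeff_of_lt _ hxR, kCoeff_of_lt _ hx', dataChart_rescaleEnd,
      pullbackBilin_comp (e.contMDiff_dataChart.mdifferentiable (by simp))
        ((e.contMDiff_rescaleBack l hl).mdifferentiable (by simp))]
    have hp : e.rescaleBack l hl ⟨x, hxR⟩ = ⟨l⁻¹ • x, hx'⟩ := rfl
    change l * (show E3 →L[ℝ] E3 →L[ℝ] ℝ from D.k (e.dataChart (e.rescaleBack l hl ⟨x, hxR⟩)))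
        ((show E3 →L[ℝ] E3 from mfderiv (𝓡 3) (𝓡 3) e.dataChart (e.rescaleBack l hl ⟨x, hxR⟩))
          (mfderiv (𝓡 3) (𝓡 3) (e.rescaleBack l hl) ⟨x, hxR⟩ v))
        ((show E3 →L[ℝ] E3 from mfderiv (𝓡 3) (𝓡 3) e.dataChart (e.rescaleBack l hl ⟨x, hxR⟩))
          (mfderiv (𝓡 3) (𝓡 3) (e.rescaleBack l hl) ⟨x, hxR⟩ w)) =
      l⁻¹ * (show E3 →L[ℝ] E3 →L[ℝ] ℝ from D.k (e.dataChart ⟨l⁻¹ • x, hx'⟩))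
        ((show E3 →L[ℝ] E3 from mfderiv (𝓡 3) (𝓡 3) e.dataChart ⟨l⁻¹ • x, hx'⟩) v)
        ((show E3 →L[ℝ] E3 from mfderiv (𝓡 3) (𝓡 3) e.dataChart ⟨l⁻¹ • x, hx'⟩) w)
    rw [mfderiv_rescaleBack_apply, mfderiv_rescaleBack_apply, hp, bilin_smul_smul]
    field_simp [hl.ne']
  · have hx' : ¬ e.R < ‖l⁻¹ • x‖ := by
      rw [norm_smul, Real.norm_of_nonneg (inv_nonneg.2 hl.le), lt_inv_mul_iff₀ hl]; exact hx
    unfold kCoeff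
    rw [dif_neg (show ¬ (e.rescaleEnd l hl).R < ‖x‖ from hx), dif_neg hx']
    simp

/-- The `k` coefficients of the rescaled data in the rescaled end, as functions:
`kCoeff' = l⁻¹ • (kCoeff e D ∘ (x ↦ x/l))`. [folklore] -/
theorem kCoeff_rescaleEnd :
    kCoeff (e.rescaleEnd l hl) (D.homothety l hl) = l⁻¹ • fun x ↦ kCoeff e D (l⁻¹ • x) := by
  funext x; ext v w
  rw [kCoeff_rescaleEnd_apply]
  rfl

end Rescale

end AFEnd

end Literature.Geometry.Lorentzian

end
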